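import Summits.MatrixMultiplication.MatrixMultiplication.Theses.SchurWeylEquivariant
import Literature.Computability.AlgebraicComplexity.TensorRestrictionRank
import Literature.Computability.AlgebraicComplexity.MatMulMonomialSubrank

-- Summit = sub-problem name (`MatrixMultiplication.MatrixMultiplication`, D-0017 single-conjunct layout).
set_option linter.dupNamespace false

/-!
# MatrixMultiplication / SchurWeylEquivariant — the assembly `Assembly`
(stmt-MatrixMultiplication-3557)

Route `MatrixMultiplication/SchurWeylEquivariant`, item stmt-MatrixMultiplication-3557 (`Assembly`,
rank 1):

  `EquivariantExponentTwo → MatrixMultiplication`.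

Proof (pure ε-bookkeeping, self-contained; it follows — but does not invoke — the route file's
kernel-checked deciding theorem `Theses.SchurWeylEquivariant.closes`). `MatrixMultiplication` is
`ω(ℂ) = 2` (`MatrixMultiplication_iff`) and `2 ≤ ω(ℂ)` is the flattening bound (`omega_two_le`), so
it suffices to show `ω(ℂ) ≤ 2 + δ` for every `δ > 0`. `EquivariantExponentTwo` at `ε = δ/2` gives
`N ≥ 1`, `r ≤ 4^{(1+δ/2)N}` and an (`S_N`-equivariant) decomposition of `T_N = ⟨2,2,2⟩^{⊠N}` into
`r` triads; forgetting equivariance, `R(⟨2^N,2^N,2^N⟩) ≤ R(T_N) ≤ r` (this is the route's support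
`EquivariantRankBound`, re-derived in two lines: `⟨2^N,2^N,2^N⟩` is `⟨2,2,2⟩^{⊠N}` read along the
base-2 un-flattening maps, `matMulTensor_pow_eq_kroneckerPow_comp`, and restriction along index
maps does not increase rank, Bläser 2013 Lemma 5.4, `tensorRank_precomp_le`;
`tensorRank_le_of_eq_sum`). Bläser 2013, Thm. 5.9 in the form
`q^{ω} ≤ R(⟨q,q,q⟩)` (`rpow_omega_le_tensorRank_matMulTensor`, `q = 2^N ≥ 2`) then gives
`(2^N)^{ω} ≤ r ≤ 4^{(1+δ/2)N} = (2^N)^{2+δ}`, hence `ω ≤ 2 + δ` because `2^N > 1`.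

References: M. Bläser, *Fast Matrix Multiplication*, Theory of Computing Graduate Surveys 5
(2013), Lemma 5.4, Thm. 5.9; J. Alman, R. Duan, V. Vassilevska Williams, Y. Xu, Z. Xu, R. Zhou,
*More asymmetry yields faster matrix multiplication*, SODA 2025, §3.4 (`⟨q,q,q⟩^{⊗n} ≡ ⟨qⁿ,qⁿ,qⁿ⟩`).
-/

noncomputable section

namespace Summit.MatrixMultiplication.MatrixMultiplication.Theorems

open Summit.MatrixMultiplication.MatrixMultiplication.Theses.SchurWeylEquivariant
open Literature.Computability.AlgebraicComplexity

/-- The ε-bookkeeping of route SchurWeylEquivariant: a decomposition of `⟨2,2,2⟩^{⊠N}` (`N ≥ 1`)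
into `r ≤ 4^{(1+ε)N}` triads (`ε` any real) gives `ω(ℂ) ≤ 2 + 2ε`
(`(2^N)^ω ≤ R(⟨2^N,2^N,2^N⟩) ≤ r ≤ (2^N)^{2+2ε}`, Bläser 2013 Lemma 5.4 and Thm. 5.9).
[cite: Blaser2013, Thm. 5.9]
[cite: AlmanDuanVassilevskaWilliamsXuXuZhou2025, §3.4] -/
theorem omega_le_two_add_of_kroneckerPow_decomposition {ε : ℝ} {N r : ℕ} (hN : 1 ≤ N)
    (hr : (r : ℝ) ≤ (4 : ℝ) ^ ((1 + ε) * N))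
    (w u v : Fin r → (Fin N → Fin 2 × Fin 2) → ℂ)
    (hdec : kroneckerPow (matMulTensor ℂ 2 2 2) N = ∑ j, triad (w j) (u j) (v j)) :
    omega ℂ ≤ 2 + 2 * ε := by
  -- `R(⟨2^N,2^N,2^N⟩) ≤ r` (forget everything but the decomposition).
  have hrank : tensorRank (matMulTensor ℂ (2 ^ N) (2 ^ N) (2 ^ N)) ≤ r :=
    calc tensorRank (matMulTensor ℂ (2 ^ N) (2 ^ N) (2 ^ N))
        ≤ tensorRank (kroneckerPow (matMulTensor ℂ 2 2 2) N) := by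
          rw [matMulTensor_pow_eq_kroneckerPow_comp ℂ 2 2 2 N]
          exact tensorRank_precomp_le _ _ _ _
      _ ≤ r := tensorRank_le_of_eq_sum w u v hdec
  -- `q = 2^N ≥ 2`.
  have hq : 2 ≤ 2 ^ N :=
    calc 2 = 2 ^ 1 := (pow_one 2).symm
      _ ≤ 2 ^ N := Nat.pow_le_pow_right (by norm_num) hN
  have hq1 : (1 : ℝ) < ((2 ^ N : ℕ) : ℝ) := by exact_mod_cast lt_of_lt_of_le (by norm_num) hq
  -- Bläser Thm. 5.9: `(2^N)^ω ≤ R(⟨2^N,2^N,2^N⟩)`.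
  have hω : ((2 ^ N : ℕ) : ℝ) ^ omega ℂ ≤
      (tensorRank (matMulTensor ℂ (2 ^ N) (2 ^ N) (2 ^ N)) : ℝ) :=
    rpow_omega_le_tensorRank_matMulTensor ℂ hq
  -- `4^{(1+ε)N} = (2^N)^{2+2ε}`.
  have h4 : (4 : ℝ) ^ ((1 + ε) * (N : ℝ)) = ((2 ^ N : ℕ) : ℝ) ^ (2 + 2 * ε) := by
    rw [show (4 : ℝ) = (2 : ℝ) ^ (2 : ℝ) by norm_num, ← Real.rpow_mul (by norm_num), Nat.cast_pow,
      Nat.cast_ofNat, ← Real.rpow_natCast, ← Real.rpow_mul (by norm_num)]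
    congr 1
    ring
  have hle : ((2 ^ N : ℕ) : ℝ) ^ omega ℂ ≤ ((2 ^ N : ℕ) : ℝ) ^ (2 + 2 * ε) :=
    calc ((2 ^ N : ℕ) : ℝ) ^ omega ℂ
        ≤ (tensorRank (matMulTensor ℂ (2 ^ N) (2 ^ N) (2 ^ N)) : ℝ) := hω
      _ ≤ (r : ℝ) := by exact_mod_cast hrank
      _ ≤ (4 : ℝ) ^ ((1 + ε) * (N : ℝ)) := hr
      _ = ((2 ^ N : ℕ) : ℝ) ^ (2 + 2 * ε) := h4
  exact (Real.rpow_le_rpow_left_iff hq1).1 hle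

/-- **Assembly of route SchurWeylEquivariant** (item stmt-MatrixMultiplication-3557), exact route
decl: `EquivariantExponentTwo → MatrixMultiplication`. Given `δ > 0`, `EquivariantExponentTwo` at
`ε = δ/2` yields `N ≥ 1`, `r ≤ 4^{(1+δ/2)N}` and an `S_N`-equivariant decomposition of
`⟨2,2,2⟩^{⊠N}` into `r` triads (equivariance is forgotten), whence `ω(ℂ) ≤ 2 + δ`
(`omega_le_two_add_of_kroneckerPow_decomposition`); so `ω(ℂ) ≤ 2`, and with `2 ≤ ω(ℂ)`
(`omega_two_le`) `ω(ℂ) = 2`, which is `MatrixMultiplication` (`MatrixMultiplication_iff`). The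
statement is literally the type of the route's deciding theorem
`Theses.SchurWeylEquivariant.closes`; the proof here is self-contained. [cite: Blaser2013, Thm. 5.9]
[cite: AlmanDuanVassilevskaWilliamsXuXuZhou2025, §3.4] -/
theorem schurWeylEquivariant_assembly_proof :
    Summit.MatrixMultiplication.MatrixMultiplication.Theses.SchurWeylEquivariant.Assembly := by
  unfold Summit.MatrixMultiplication.MatrixMultiplication.Theses.SchurWeylEquivariant.Assembly
    EquivariantExponentTwo
  intro hX
  rw [_root_.MatrixMultiplication_iff]
  refine le_antisymm ?_ (omega_two_le ℂ)
  refine le_of_forall_pos_le_add fun δ hδ => ?_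
  obtain ⟨N, hN, r, hr, w, u, v, hdec, -⟩ := hX (δ / 2) (by positivity)
  have h := omega_le_two_add_of_kroneckerPow_decomposition hN hr w u v hdec
  linarith

end Summit.MatrixMultiplication.MatrixMultiplication.Theorems

end
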